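import Literature.MathematicalPhysics.QuantumFieldTheory.TorusChartFlatCochains
import HarnessLib

/-!
# Crux `BirComplexStableXYR`, line `fat-gaussian-defect-calculus`: stub B4 `stub_sectorLabel`

Registered stub (lead c7, skeleton `Cruxes/BirComplexStableXYR/Lines/fat_gaussian_defect_calculus.lean`), helper
(`--supports`) for the crux `Summit.HubbardSuperconductivity.HubbardSuperconductivity.Theses.BalabanIR.BirComplexStableXYR`:
**sector labels.**  Two integer `1`-cochains `a, a'` on a charted torus `F : TorusChart Λ d` are gauge equivalent
(`a' = a + d₀ n` for some `n : Λ → ℤ`) iff they have the same vorticity `d₁ a' = d₁ a` and the same axial windings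
`wind a' = wind a`.  Hence the gauge classes `a + d₀ℤ^Λ` of the Fröhlich–Spencer representation are labelled by the pair
`(q, h) = (d₁ a, wind a)` (vortex current, holonomy).

Proof: seat 1's `TorusChart.exists_d₀_eq_iff` (gradients are exactly the flat cochains with zero winding vector) applied
to the difference `a' − a`, together with `d₁_sub` / `wind_sub` and `sub_eq_zero`.  No definitions; sorry-free.
-/

set_option linter.dupNamespace false -- summit = problem name (single-conjunct summit), D-0017

namespace Summit.HubbardSuperconductivity.HubbardSuperconductivity.Theorems.FSUnfolding

open Literature.MathematicalPhysics.QuantumFieldTheory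

/-- **Flatness is the vanishing of the curl** as a `2`-cochain: `IsFlat θ ↔ d₁ θ = 0`. [folklore] -/
theorem torusChart_isFlat_iff_d₁_eq_zero {Λ : Type*} [AddCommGroup Λ] {d : ℕ} (F : TorusChart Λ d)
    {A : Type*} [AddCommGroup A] (θ : Λ → Fin d → A) : F.IsFlat θ ↔ F.d₁ θ = 0 := by
  constructor
  · intro h
    funext x i j
    exact h x i j
  · intro h x i j
    rw [h]
    rfl

/-- **A difference is flat iff the curls agree**: `IsFlat (θ − η) ↔ d₁ θ = d₁ η`. [folklore] -/
theorem torusChart_isFlat_sub_iff {Λ : Type*} [AddCommGroup Λ] {d : ℕ} (F : TorusChart Λ d)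
    {A : Type*} [AddCommGroup A] (θ η : Λ → Fin d → A) : F.IsFlat (θ - η) ↔ F.d₁ θ = F.d₁ η := by
  rw [torusChart_isFlat_iff_d₁_eq_zero, F.d₁_sub, sub_eq_zero]

/-- **Gauge classes are labelled by curl and winding** (any coefficient group): `θ' = θ + d₀ f` for some `f` iff
`d₁ θ' = d₁ θ` and `wind θ' = wind θ`. [folklore: Fröhlich–Spencer, CMP 81 (1981) §3] -/
theorem torusChart_exists_eq_add_d₀_iff {Λ : Type*} [AddCommGroup Λ] {d : ℕ} (F : TorusChart Λ d)
    {A : Type*} [AddCommGroup A] (θ θ' : Λ → Fin d → A) :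
    (∃ f : Λ → A, θ' = θ + F.d₀ f) ↔ (F.d₁ θ' = F.d₁ θ ∧ F.wind θ' = F.wind θ) := by
  have key : (∃ f : Λ → A, θ' - θ = F.d₀ f) ↔ F.IsFlat (θ' - θ) ∧ F.wind (θ' - θ) = 0 :=
    F.exists_d₀_eq_iff (θ' - θ)
  rw [torusChart_isFlat_sub_iff, F.wind_sub, sub_eq_zero] at key
  rw [← key]
  refine exists_congr fun f => ?_
  rw [sub_eq_iff_eq_add']

/-- **stub B4 (S): sector labels.**  Two integer `1`-cochains on a charted torus are gauge equivalent (`a' = a + d₀n`)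
iff they have the same vorticity `d₁` and the same axial windings `wind` (seat 1's `exists_d₀_eq_iff` applied to
`a' − a`).  Hence the sectors of the Fröhlich–Spencer representation are labelled by `(q, h) = (d₁a, wind a)`: vortex
current and holonomy. [folklore: Fröhlich–Spencer, CMP 81 (1981) §3] -/
theorem stub_sectorLabel :
    ∀ (Λ : Type) [AddCommGroup Λ] (d : ℕ) (F : TorusChart Λ d) (a a' : Λ → Fin d → ℤ),
      (∃ n : Λ → ℤ, a' = a + F.d₀ n) ↔ (F.d₁ a' = F.d₁ a ∧ F.wind a' = F.wind a) := by
  intro Λ _ d F a a'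
  exact torusChart_exists_eq_add_d₀_iff F a a'

end Summit.HubbardSuperconductivity.HubbardSuperconductivity.Theorems.FSUnfolding
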